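import Summits.CriticalPhenomena.PercolationContinuityZ3.Theorems.Transplant.SkelPhiLinkedSide
import Summits.CriticalPhenomena.PercolationContinuityZ3.Theorems.Transplant.KNLevelsStepIV
import Summits.CriticalPhenomena.PercolationContinuityZ3.Theorems.Transplant.UniqZoneGeneric
import HarnessLib

/-!
# D″ node, STRUCTURE-FREE layer L5′.3a (V98 p3 column; P4-GENERAL §16.2 (i), §16.6; DPRIME-SCOPE p3 addendum L.4): STEP I′ — the θ-dependent
# INPUT FAMILY of route D″ v2 as an explicit finite family of cylinder events over GENERIC Step-I′ data `D : StepI.Data V` (zone family `D.Λ t`,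
# seed level `D.k`, kit radius `D.R`, band inputs `D.Gb / D.Fb`), indexed WITHOUT `HOct 2`: the uniqueness zone of `D.Λ t` between `D.k` and `M`,
# and the links from the seed `D.Λ t D.k` to the four SIDE-HALVES of the band rectangle of every extent along each axis inside its fat rectangle
# `rectPrism t a (D.R (amax a))` — definitions, locality, unpacking; the certification at `p` (which CONSTRUCTS `D`: shifted fat prisms,
# `fatRadius`, the band envelopes) is `SkelPhiScalesCert`

builds on p205010 (kernel theorem, internal audit signed; external expert review pending) — nothing in this file uses p205010.
Lane `prim-bschramm`, seat `prim-bschramm-p3` (gen 7; D″ design owner); helper file (`--supports stmt-CriticalPhenomena-4575`).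
Supersedes in intent the fixed-data draft `SkelPhiScales` (p248110: seed `fatSeq t (msel t)`), whose seed cannot be shown to touch the lines `α, β = ±m`
that LEVEL 0's trivial ends need (`fatRadius m ≥ cylRad t m m` is not provable); with `D.Λ` a datum the certification uses the SHIFTED fat prisms
`cylBallFin t j (fatRadius j + off)`, `off ≥ cylRadMax m m`, and every consumer (two-scale kit `KNLevels.stepIV_out` with `Λ := D.Λ c`, `k := D.k`;
LEVEL-1 chains; the `p ↦ q₀` transfer on `index`) is typed against `D` once.
* §1 `widths Gb Fb i ℓ` (`(ℓ, Gb ℓ)` / `(Fb ℓ, ℓ)`), `Idx V`, **`Data V`** (`Λ k R Gb Fb`);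
* §2 **`event G φ D : Idx V → Set (BondConfig V)`**, `edges`, **`determinedBy_event`**, `measurableSet_event`;
* §3 **`index types Sz Sx Sy`**, `mem_index_none / _zero / _one`, `fst_mem_of_mem_index`, **`unpack`** (at a running density `q`: zone at every `M ∈ Sz`,
  x-halves at every `ℓ ∈ Sx`, y-halves at every `ℓ ∈ Sy`), `real_linkIn_rside_ge_rhalf` (sides from halves).
[cite: KozmaNitzan2024, §4 p. 17 (Step I: the scales m, M), Lemma 7 (p. 15), Lemma 9 (p. 16), p. 16 (hittable geometries are events of finite boxes)]
-/

noncomputable section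

open MeasureTheory

namespace Summit.CriticalPhenomena.PercolationContinuityZ3.Theorems.Transplant

namespace Skelφ

namespace StepI

open Literature.Probability.Percolation Literature.Probability.LatticeModels SimpleGraph KNLevels
open Literature.Probability.Percolation.KozmaNitzan.Cells (oth oth_ne oth_oth eq_oth_of_ne)
open scoped Classical

variable {V : Type} [DecidableEq V] {G : SimpleGraph V} [G.LocallyFinite] {φ : V → Site 2} {types : Finset V}

/-! ## §1 Band half-widths, the index type, the data -/

omit [DecidableEq V] [G.LocallyFinite] in
/-- **The half-widths of the band rectangle of extent `ℓ` along axis `i`**: `(ℓ, Gb ℓ)` for `i = 0`, `(Fb ℓ, ℓ)` for `i = 1`.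
[cite: KozmaNitzan2024, §4 p. 16 (the hittable geometry (F, Q))] -/
def widths (Gb Fb : ℕ → ℕ) (i : Fin 2) (ℓ : ℕ) : Fin 2 → ℕ := fun j => if j = i then ℓ else if i = 0 then Gb ℓ else Fb ℓ

omit [DecidableEq V] [G.LocallyFinite] in
/-- The extent coordinate. [folklore] -/
@[simp] theorem widths_self (Gb Fb : ℕ → ℕ) (i : Fin 2) (ℓ : ℕ) : widths Gb Fb i ℓ i = ℓ := by simp [widths]

omit [DecidableEq V] [G.LocallyFinite] in
/-- The transverse coordinate for `i = 0`. [folklore] -/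
@[simp] theorem widths_zero_one (Gb Fb : ℕ → ℕ) (ℓ : ℕ) : widths Gb Fb 0 ℓ 1 = Gb ℓ := by simp [widths]

omit [DecidableEq V] [G.LocallyFinite] in
/-- The transverse coordinate for `i = 1`. [folklore] -/
@[simp] theorem widths_one_zero (Gb Fb : ℕ → ℕ) (ℓ : ℕ) : widths Gb Fb 1 ℓ 0 = Fb ℓ := by simp [widths]

omit [DecidableEq V] [G.LocallyFinite] in
/-- The extent is at most the larger half-width. [folklore] -/
theorem le_amax_widths (Gb Fb : ℕ → ℕ) (i : Fin 2) (ℓ : ℕ) : ℓ ≤ amax (widths Gb Fb i ℓ) := by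
  have := le_amax (widths Gb Fb i ℓ) i
  rwa [widths_self] at this

/-- The index type of the input family: base vertex × scale/extent × (`none` = zone | `some (axis, side sign, half sign)`). [this work] -/
abbrev Idx (V : Type) := V × ℕ × Option (Fin 2 × ℤˣ × ℤˣ)

/-- **Step-I′ data** (all fixed at the reference density by `SkelPhiScalesCert`, arguments everywhere else): the zone family `Λ t` at each base
vertex (nested, exhausting — the shifted fat prisms), the seed level `k`, the kit radius `R n` at planar scale `n` (the fat radius), the band inputs
`Gb`, `Fb`. [this work] -/
structure Data (V : Type) where
  /-- the zone family at a base vertex -/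
  Λ : V → ℕ → Finset V
  /-- the seed level: the seed at `t` is `Λ t k` -/
  k : ℕ
  /-- the kit radius at planar scale `n` -/
  R : ℕ → ℕ
  /-- band height `G(ℓ)` for x-steps -/
  Gb : ℕ → ℕ
  /-- band width `F⁻¹(ℓ)` for y-steps -/
  Fb : ℕ → ℕ

/-! ## §2 The input events -/

section Events

variable (G φ) (D : Data V)

/-- **The input events of route D″ v2**: the uniqueness zone of `D.Λ t` between `D.k` and `M` (`none`), and the link from the seed `D.Λ t D.k` to the
side-half `(i, σ, τ)` of the band rectangle of extent `ℓ` inside its fat rectangle (`some (i, σ, τ)`). [cite: KozmaNitzan2024, §4 Lemma 7 (p. 15), Lemma 9 (p. 16)] -/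
def event : Idx V → Set (BondConfig V)
  | (t, M, none) => UniqZone.zone G (D.Λ t) D.k M
  | (t, ℓ, some (i, σ, τ)) =>
      linkIn (rectPrism G φ t (widths D.Gb D.Fb i ℓ) (D.R (amax (widths D.Gb D.Fb i ℓ)))) (D.Λ t D.k)
        (rhalf G φ t (widths D.Gb D.Fb i ℓ) (D.R (amax (widths D.Gb D.Fb i ℓ))) i (σ : ℤ) (τ : ℤ))

/-- **The finite edge support** of an input event: the pairs inside the zone box, resp. inside the fat rectangle. [folklore] -/
def edges : Idx V → Finset (Sym2 V)
  | (t, M, none) => pairsF (D.Λ t M)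
  | (t, ℓ, some (i, _, _)) => pairsF (rectPrismFin G φ t (widths D.Gb D.Fb i ℓ) (D.R (amax (widths D.Gb D.Fb i ℓ))))

/-- The zone input, unfolded. [folklore] -/
@[simp] theorem event_none (t : V) (M : ℕ) : event G φ D (t, M, none) = UniqZone.zone G (D.Λ t) D.k M := rfl

/-- The link input, unfolded. [folklore] -/
@[simp] theorem event_some (t : V) (ℓ : ℕ) (i : Fin 2) (σ τ : ℤˣ) :
    event G φ D (t, ℓ, some (i, σ, τ)) =
      linkIn (rectPrism G φ t (widths D.Gb D.Fb i ℓ) (D.R (amax (widths D.Gb D.Fb i ℓ)))) (D.Λ t D.k)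
        (rhalf G φ t (widths D.Gb D.Fb i ℓ) (D.R (amax (widths D.Gb D.Fb i ℓ))) i (σ : ℤ) (τ : ℤ)) := rfl

/-- **Every input event is determined by the pairs of its support** (a cylinder event on finitely many coordinates — so the `p ↦ q₀` transfer is
continuity of finitely many polynomials). [cite: KozmaNitzan2024, §4 p. 16 (hittable geometries are events of finite boxes)] -/
theorem determinedBy_event (i : Idx V) : DeterminedBy (event G φ D i) (↑(edges G φ D i) : Set (Sym2 V)) := by
  obtain ⟨t, M, og⟩ := i
  rcases og with _ | ⟨ax, σ, τ⟩
  · exact determinedBy_zone _ _ _ (by rw [edges, coe_pairsF])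
  · refine determinedBy_linkIn _ _ _ ?_
    rw [edges, coe_pairsF, coe_rectPrismFin]

/-- Input events are measurable. [folklore] -/
theorem measurableSet_event (i : Idx V) : MeasurableSet (event G φ D i) := (determinedBy_event G φ D i).measurableSet_of_finset

end Events

/-! ## §3 The finite index set and the unpacking at a running density -/

omit [DecidableEq V] [G.LocallyFinite] in
/-- **The finite index set** of the inputs: base vertices × (zone scales `Sz` | x-extents `Sx` × signs | y-extents `Sy` × signs). [folklore] -/
def index (types : Finset V) (Sz Sx Sy : Finset ℕ) : Finset (Idx V) :=
  types ×ˢ ((Sz ×ˢ ({none} : Finset (Option (Fin 2 × ℤˣ × ℤˣ)))) ∪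
    (Sx ×ˢ ((Finset.univ : Finset (ℤˣ × ℤˣ)).image fun στ => some ((0 : Fin 2), στ))) ∪
    (Sy ×ˢ ((Finset.univ : Finset (ℤˣ × ℤˣ)).image fun στ => some ((1 : Fin 2), στ))))

omit [DecidableEq V] [G.LocallyFinite] in
/-- Zone indices. [folklore] -/
theorem mem_index_none {Sz Sx Sy : Finset ℕ} {t : V} (ht : t ∈ types) {M : ℕ} (hM : M ∈ Sz) : (t, M, none) ∈ index types Sz Sx Sy := by
  simp only [index, Finset.mem_product, Finset.mem_union, Finset.mem_singleton]
  exact ⟨ht, Or.inl (Or.inl ⟨hM, trivial⟩)⟩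

omit [DecidableEq V] [G.LocallyFinite] in
/-- x-link indices. [folklore] -/
theorem mem_index_zero {Sz Sx Sy : Finset ℕ} {t : V} (ht : t ∈ types) {ℓ : ℕ} (hℓ : ℓ ∈ Sx) (σ τ : ℤˣ) :
    (t, ℓ, some (0, σ, τ)) ∈ index types Sz Sx Sy := by
  simp only [index, Finset.mem_product, Finset.mem_union, Finset.mem_image, Finset.mem_univ, true_and]
  exact ⟨ht, Or.inl (Or.inr ⟨hℓ, (σ, τ), rfl⟩)⟩

omit [DecidableEq V] [G.LocallyFinite] in
/-- y-link indices. [folklore] -/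
theorem mem_index_one {Sz Sx Sy : Finset ℕ} {t : V} (ht : t ∈ types) {ℓ : ℕ} (hℓ : ℓ ∈ Sy) (σ τ : ℤˣ) :
    (t, ℓ, some (1, σ, τ)) ∈ index types Sz Sx Sy := by
  simp only [index, Finset.mem_product, Finset.mem_union, Finset.mem_image, Finset.mem_univ, true_and]
  exact ⟨ht, Or.inr ⟨hℓ, (σ, τ), rfl⟩⟩

omit [DecidableEq V] [G.LocallyFinite] in
/-- The base vertex of an index is a base vertex. [folklore] -/
theorem fst_mem_of_mem_index {Sz Sx Sy : Finset ℕ} {i : Idx V} (hi : i ∈ index types Sz Sx Sy) : i.1 ∈ types := (Finset.mem_product.1 hi).1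

section Unpack

variable (D : Data V)

/-- **Unpacking the inputs at a running density `q`**: if every input over `index types Sz Sx Sy` has probability `> 1 − δ` at `q`, then at every base
vertex: the zone holds at every `M ∈ Sz`, and the four halves of the band rectangle of every extent `ℓ ∈ Sx` (axis `0`) / `ℓ ∈ Sy` (axis `1`) are linked
from the seed inside the fat rectangle, each with probability `> 1 − δ` (the `h1`/`h2` shapes of `KNLevels.stepIV_out` and of the chain steps).
[cite: KozmaNitzan2024, §4 p. 17 (Step I)] -/
theorem unpack [Countable V] {Sz Sx Sy : Finset ℕ} {q : unitInterval} {δ : ℝ}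
    (h : ∀ i ∈ index types Sz Sx Sy, 1 - δ < (bondPercolation G q).real (event G φ D i)) {t : V} (ht : t ∈ types) :
    (∀ M ∈ Sz, 1 - δ < (bondPercolation G q).real (UniqZone.zone G (D.Λ t) D.k M)) ∧
      (∀ ℓ ∈ Sx, ∀ σ τ : ℤˣ, 1 - δ < (bondPercolation G q).real
        (linkIn (rectPrism G φ t (widths D.Gb D.Fb 0 ℓ) (D.R (amax (widths D.Gb D.Fb 0 ℓ)))) (D.Λ t D.k)
          (rhalf G φ t (widths D.Gb D.Fb 0 ℓ) (D.R (amax (widths D.Gb D.Fb 0 ℓ))) 0 (σ : ℤ) (τ : ℤ)))) ∧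
      (∀ ℓ ∈ Sy, ∀ σ τ : ℤˣ, 1 - δ < (bondPercolation G q).real
        (linkIn (rectPrism G φ t (widths D.Gb D.Fb 1 ℓ) (D.R (amax (widths D.Gb D.Fb 1 ℓ)))) (D.Λ t D.k)
          (rhalf G φ t (widths D.Gb D.Fb 1 ℓ) (D.R (amax (widths D.Gb D.Fb 1 ℓ))) 1 (σ : ℤ) (τ : ℤ)))) :=
  ⟨fun _ hM => h _ (mem_index_none ht hM),
    fun _ hℓ σ τ => h _ (mem_index_zero ht hℓ σ τ),
    fun _ hℓ σ τ => h _ (mem_index_one ht hℓ σ τ)⟩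

omit [DecidableEq V] in
/-- **Directed sides from halves**: a link to a side-half is a link to the side (`rhalf ⊆ rside`). [folklore] -/
theorem real_linkIn_rside_ge_rhalf [Countable V] (q : unitInterval) (t : V) (a : Fin 2 → ℕ) (R : ℕ) (B : Finset V) (i : Fin 2) (σ τ : ℤ) :
    (bondPercolation G q).real (linkIn (rectPrism G φ t a R) B (rhalf G φ t a R i σ τ)) ≤
      (bondPercolation G q).real (linkIn (rectPrism G φ t a R) B (rside G φ t a R i σ)) :=
  measureReal_mono (linkIn_mono subset_rfl subset_rfl (rhalf_subset G φ t a R i σ τ)) (measure_ne_top _ _)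

end Unpack

end StepI

end Skelφ

end Summit.CriticalPhenomena.PercolationContinuityZ3.Theorems.Transplant

end
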